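import Mathlib.Analysis.Fourier.AddCircle
import Mathlib.MeasureTheory.Integral.IntervalIntegral.Basic
import Mathlib.Analysis.SpecialFunctions.Integrals.Basic
import Mathlib.Tactic
import HarnessLib

/-!
# The box discrepancy and LeVeque's inequality

For `y₁, …, y_N ∈ [0,1)` the (normalised, box) **discrepancy** is
`D(y) = sup_{[a,b] ⊆ [0,1]} |(b − a) − #{i : yᵢ ∈ [a,b]}/N|`
(Calegari–Dimitrov–Tang, arXiv:2408.15403, §4.1 Definition 44, p. 41; Kuipers–Niederreiter Ch. 2
§1 with half-open intervals — immaterial here), and the Weyl sums are `S_h = Σ_n e^{2πi h y_n}`.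
**LeVeque's inequality** (W. J. LeVeque 1965; Kuipers–Niederreiter, *Uniform distribution of
sequences*, Ch. 2, Theorem 2.4) bounds the discrepancy by the Weyl sums:

  `D³ ≤ (6/π²) Σ_{h ≥ 1} (1/h²) |S_h / N|²`.

CDT derive their measure-concentration estimate (Theorem 45) from the Erdős–Turán inequality;
LeVeque's inequality is an alternative input of the same shape (only character sums and
absolute constants), which is what the sequel file uses.

## Proof (Kuipers–Niederreiter's, via Parseval)

With `Δ(t) = #{n : y_n < t}/N − t` and `m = ∫₀¹ Δ`: the Fourier coefficients of `Δ − m` on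
`[0,1]` are `ĉ(h) = S_{−h}/(2πihN)` (`h ≠ 0`), `ĉ(0) = 0`, so Parseval gives
`∫₀¹ (Δ − m)² = Σ_{h≥1} |S_h|²/(2π²h²N²)` (`HolonomyBound…`-free, purely Mathlib:
`hasSum_sq_fourierCoeffOn`). On the other hand `Δ` has slope `−1` between upward jumps, so from a
point where `Δ − m` is within `η` of its supremum `u` it stays above `u − η − ℓ` along the
following arc of length `ℓ`, and symmetrically below `−(v − η) + ℓ'` before a point where it is
within `η` of its infimum `−v`; the two regions are disjoint (`Δ − m > 0` resp. `< 0` there),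
whence `∫(Δ − m)² ≥ (u³ + v³)/3 ≥ (u + v)³/12 ≥ D³/12` (every local discrepancy is a difference
of two values/right limits of `Δ`, so `D ≤ u + v`).

* `Discrepancy.boxDiscrepancy` (CDT Def. 44), `Discrepancy.localDisc`, `Discrepancy.delta`,
  `Discrepancy.weylSum`, `Discrepancy.meanDelta`, `Discrepancy.centred`, `Discrepancy.arcLen`,
  `Discrepancy.countLT/LE`.
* `Discrepancy.fourierCoeffOn_centred` — `ĉ(h) = S_{−h}/(2πihN)`.
* `Discrepancy.hasSum_weylSum_sq` — Parseval: `Σ_{n≥1} ‖S_n‖²/(2π²n²N²) = ∫₀¹(Δ − m)²`.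
* `Discrepancy.boxDiscrepancy_le_osc` — `D ≤ sup Δ − inf Δ`.
* `Discrepancy.leVeque` — **LeVeque's inequality**.

No named facts.

## References

* [LeVeque1965] W. J. LeVeque, *An inequality connected with Weyl's criterion for uniform
  distribution*, Proc. Sympos. Pure Math. VIII (1965), 22–30.
* [KuipersNiederreiter1974] L. Kuipers, H. Niederreiter, *Uniform distribution of sequences*,
  Wiley 1974, Ch. 2, Theorem 2.4.
* [CalegariDimitrovTang2024] arXiv:2408.15403, §4.1 Definition 44 (p. 41).
-/

noncomputable section

open MeasureTheory Set Filter Topology intervalIntegral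

namespace Literature.NumberTheory.DiophantineApproximation

namespace Discrepancy

variable {N : ℕ}

/-- The number of indices `n` with `y n < t`. [folklore] -/
def countLT (y : Fin N → ℝ) (t : ℝ) : ℕ := (Finset.univ.filter fun n => y n < t).card

/-- The number of indices `n` with `y n ≤ t`. [folklore] -/
def countLE (y : Fin N → ℝ) (t : ℝ) : ℕ := (Finset.univ.filter fun n => y n ≤ t).card

/-- The counting (local discrepancy) function `Δ(t) = #{n : y_n < t}/N − t`
(Kuipers–Niederreiter's `R_N(t)/N`). [cite: KuipersNiederreiter1974, Ch. 2 §2, proof of Theorem 2.4] -/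
def delta (y : Fin N → ℝ) (t : ℝ) : ℝ := (countLT y t : ℝ) / N - t

/-- The local discrepancy of the closed interval `[a, b]`:
`|(b − a) − #{n : a ≤ y_n ≤ b}/N|`. [cite: CalegariDimitrovTang2024, §4.1 Definition 44 (p. 41)] -/
def localDisc (y : Fin N → ℝ) (a b : ℝ) : ℝ :=
  |(b - a) - ((Finset.univ.filter fun n => a ≤ y n ∧ y n ≤ b).card : ℝ) / N|

/-- CDT Definition 44: the (normalised, box) discrepancy of `y₁,…,y_N ∈ [0,1)`: the supremum over
closed subintervals `[a,b] ⊆ [0,1]` of the local discrepancies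
`D(y) = sup_I |μ(I) − #{i : yᵢ ∈ I}/N|`. [cite: CalegariDimitrovTang2024, §4.1 Definition 44 (p. 41)] -/
def boxDiscrepancy (y : Fin N → ℝ) : ℝ :=
  sSup ((fun ab : ℝ × ℝ => localDisc y ab.1 ab.2) '' {ab | 0 ≤ ab.1 ∧ ab.1 ≤ ab.2 ∧ ab.2 ≤ 1})

variable (y : Fin N → ℝ)

/-- `#{y_n < t}` is monotone in `t`. [folklore] -/
theorem countLT_mono {s t : ℝ} (h : s ≤ t) : countLT y s ≤ countLT y t :=
  Finset.card_le_card (fun n hn => by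
    simp only [Finset.mem_filter, Finset.mem_univ, true_and] at hn ⊢; exact lt_of_lt_of_le hn h)

/-- `#{y_n < t} ≤ N`. [folklore] -/
theorem countLT_le : ∀ t, countLT y t ≤ N := fun t =>
  (Finset.card_le_univ _).trans (by simp)

/-- `#{y_n < t} − #{y_n < s} = #{s ≤ y_n < t} ≥ 0`: the arc inequality
`Δ(t) − Δ(s) ≥ −(t − s)` for `s ≤ t`. [folklore] -/
theorem delta_sub_delta_ge {s t : ℝ} (h : s ≤ t) : -(t - s) ≤ delta y t - delta y s := by
  unfold delta
  have h1 : (countLT y s : ℝ) ≤ countLT y t := by exact_mod_cast countLT_mono y h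
  have hN : (0 : ℝ) ≤ N := Nat.cast_nonneg N
  have : (countLT y s : ℝ) / N ≤ (countLT y t : ℝ) / N := div_le_div_of_nonneg_right h1 hN
  linarith

variable {y}

/-- `Δ(0) = 0` for points in `[0,1)`. [folklore] -/
theorem delta_zero (hy : ∀ n, 0 ≤ y n) : delta y 0 = 0 := by
  unfold delta countLT
  have : (Finset.univ.filter fun n => y n < 0) = ∅ :=
    Finset.filter_eq_empty_iff.mpr fun n _ => not_lt.mpr (hy n)
  simp [this]

/-- `Δ(1) = 0` for points in `[0,1)`. [folklore] -/
theorem delta_one (hN : 0 < N) (hy : ∀ n, y n < 1) : delta y 1 = 0 := by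
  unfold delta countLT
  have : (Finset.univ.filter fun n => y n < 1) = Finset.univ :=
    Finset.filter_eq_self.mpr fun n _ => hy n
  rw [this, Finset.card_univ, Fintype.card_fin, div_self (by exact_mod_cast hN.ne')]; simp

/-- The arc inequality around the circle: for `x₀, x ∈ [0,1]`,
`Δ(x) ≥ Δ(x₀) − ℓ`, `ℓ` the length of the arc from `x₀` to `x` in the positive direction. [folklore] -/
theorem delta_ge_of_arc (hN : 0 < N) (hy0 : ∀ n, 0 ≤ y n) (hy1 : ∀ n, y n < 1) {x₀ x : ℝ}
    (hx₀ : x₀ ∈ Icc (0 : ℝ) 1) (hx : x ∈ Icc (0 : ℝ) 1) :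
    delta y x₀ - (if x₀ ≤ x then x - x₀ else 1 - x₀ + x) ≤ delta y x := by
  split_ifs with h
  · have := delta_sub_delta_ge y h; linarith
  · push Not at h
    have h1 := delta_sub_delta_ge y hx.1      -- from 0 to x
    have h2 := delta_sub_delta_ge y hx₀.2     -- from x₀ to 1
    rw [delta_zero hy0] at h1
    rw [delta_one hN hy1] at h2
    linarith

/-- The arc inequality, upper form: `Δ(x) ≤ Δ(x₁) + ℓ'`, `ℓ'` the length of the arc from `x`
to `x₁` in the positive direction. [folklore] -/
theorem delta_le_of_arc (hN : 0 < N) (hy0 : ∀ n, 0 ≤ y n) (hy1 : ∀ n, y n < 1) {x₁ x : ℝ}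
    (hx₁ : x₁ ∈ Icc (0 : ℝ) 1) (hx : x ∈ Icc (0 : ℝ) 1) :
    delta y x ≤ delta y x₁ + (if x ≤ x₁ then x₁ - x else 1 - x + x₁) := by
  split_ifs with h
  · have := delta_sub_delta_ge y h; linarith
  · push Not at h
    have h1 := delta_sub_delta_ge y hx₁.1
    have h2 := delta_sub_delta_ge y hx.2
    rw [delta_zero hy0] at h1
    rw [delta_one hN hy1] at h2
    linarith

/-- `|Δ(t) − Δ(s)| ≤ 1` on `[0,1]`, hence `Δ` is bounded by `1` (`Δ(0) = 0`). [folklore] -/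
theorem abs_delta_le (hN : 0 < N) (hy0 : ∀ n, 0 ≤ y n) (hy1 : ∀ n, y n < 1) {t : ℝ}
    (ht : t ∈ Icc (0 : ℝ) 1) : |delta y t| ≤ 1 := by
  have h1 := delta_ge_of_arc hN hy0 hy1 (x₀ := 0) ⟨le_rfl, zero_le_one⟩ ht
  have h2 := delta_le_of_arc hN hy0 hy1 (x₁ := 1) ⟨zero_le_one, le_rfl⟩ ht
  rw [delta_zero hy0, if_pos ht.1] at h1
  rw [delta_one hN hy1, if_pos ht.2] at h2
  rw [abs_le]; constructor <;> linarith [ht.1, ht.2]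

/-! ### The local discrepancies are controlled by the oscillation of `Δ` -/

/-- `#{a ≤ y_n ≤ b} = #{y_n ≤ b} − #{y_n < a}` for `a ≤ b`. [folklore] -/
theorem card_Icc_eq (y : Fin N → ℝ) {a b : ℝ} (hab : a ≤ b) :
    ((Finset.univ.filter fun n => a ≤ y n ∧ y n ≤ b).card : ℝ) = countLE y b - countLT y a := by
  have hsub : (Finset.univ.filter fun n => y n < a) ⊆ (Finset.univ.filter fun n => y n ≤ b) := by
    intro n hn
    simp only [Finset.mem_filter, Finset.mem_univ, true_and] at hn ⊢
    linarith
  have heq : (Finset.univ.filter fun n => a ≤ y n ∧ y n ≤ b) =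
      (Finset.univ.filter fun n => y n ≤ b) \ (Finset.univ.filter fun n => y n < a) := by
    ext n
    simp only [Finset.mem_filter, Finset.mem_univ, true_and, Finset.mem_sdiff, not_lt]
    tauto
  rw [heq, Finset.card_sdiff_of_subset hsub, Nat.cast_sub (Finset.card_le_card hsub)]
  rfl

/-- The right limit `Δ(b⁺) = #{y_n ≤ b}/N − b` lies between `inf Δ` and `sup Δ` on `[0,1]`. [folklore] -/
theorem deltaPlus_mem (hy1 : ∀ n, y n < 1) {b : ℝ}
    (hb : b ∈ Icc (0 : ℝ) 1) {L U : ℝ} (hL : ∀ t ∈ Icc (0 : ℝ) 1, L ≤ delta y t)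
    (hU : ∀ t ∈ Icc (0 : ℝ) 1, delta y t ≤ U) :
    L ≤ (countLE y b : ℝ) / N - b ∧ (countLE y b : ℝ) / N - b ≤ U := by
  rcases eq_or_lt_of_le hb.2 with rfl | hb1
  · -- `b = 1`: `Δ(1⁺) = Δ(1) = 0`
    have hc : (countLE y 1 : ℝ) / N - 1 = delta y 1 := by
      unfold delta countLE countLT
      have e1 : (Finset.univ.filter fun n => y n ≤ 1) = Finset.univ :=
        Finset.filter_eq_self.mpr fun n _ => (hy1 n).le
      have e2 : (Finset.univ.filter fun n => y n < 1) = Finset.univ :=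
        Finset.filter_eq_self.mpr fun n _ => hy1 n
      rw [e1, e2]
    rw [hc]
    exact ⟨hL 1 hb, hU 1 hb⟩
  · -- `b < 1`: no point in `(b, t₀)`
    classical
    set A := Finset.univ.filter (fun n => b < y n) with hA
    set t₀ : ℝ := if h : A.Nonempty then min 1 (A.inf' h y) else 1 with ht₀
    have ht₀b : b < t₀ := by
      rw [ht₀]; split_ifs with h
      · refine lt_min hb1 ?_
        rw [Finset.lt_inf'_iff]
        intro n hn
        exact (Finset.mem_filter.mp hn).2
      · exact hb1
    have ht₀1 : t₀ ≤ 1 := by rw [ht₀]; split_ifs <;> simp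
    have hcount : ∀ t, b < t → t < t₀ → countLT y t = countLE y b := by
      intro t hbt htt
      unfold countLT countLE
      congr 1
      ext n
      simp only [Finset.mem_filter, Finset.mem_univ, true_and]
      constructor
      · intro hnt
        by_contra hnb
        push Not at hnb
        have hnA : n ∈ A := Finset.mem_filter.mpr ⟨Finset.mem_univ _, hnb⟩
        have hne : A.Nonempty := ⟨n, hnA⟩
        have : t₀ ≤ y n := by
          rw [ht₀, dif_pos hne]
          exact (min_le_right _ _).trans (Finset.inf'_le _ hnA)
        linarith
      · intro hnb; linarith
    have hdelta : ∀ t, b < t → t < t₀ → delta y t = (countLE y b : ℝ) / N - b - (t - b) := by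
      intro t hbt htt
      unfold delta
      rw [hcount t hbt htt]
      ring
    constructor
    · -- lower bound via the midpoint
      set t := (b + t₀) / 2 with ht
      have hbt : b < t := by rw [ht]; linarith
      have htt : t < t₀ := by rw [ht]; linarith
      have htI : t ∈ Icc (0 : ℝ) 1 := ⟨by linarith [hb.1], by linarith⟩
      have h1 := hL t htI
      rw [hdelta t hbt htt] at h1
      linarith
    · -- upper bound: `Δ(b⁺) ≤ U + (t − b)` for all `t ∈ (b, t₀)`
      apply le_of_forall_pos_lt_add
      intro ε hε
      set t := b + min (ε / 2) ((t₀ - b) / 2) with ht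
      have hmin : 0 < min (ε / 2) ((t₀ - b) / 2) := lt_min (by linarith) (by linarith)
      have hbt : b < t := by rw [ht]; linarith
      have htt : t < t₀ := by
        rw [ht]; have := min_le_right (ε / 2) ((t₀ - b) / 2); linarith
      have htI : t ∈ Icc (0 : ℝ) 1 := ⟨by linarith [hb.1], by linarith⟩
      have h1 := hU t htI
      rw [hdelta t hbt htt] at h1
      have := min_le_left (ε / 2) ((t₀ - b) / 2)
      linarith

/-- **The discrepancy is at most the oscillation of `Δ`**: if `L ≤ Δ ≤ U` on `[0,1]` then
`D ≤ U − L`. [folklore] -/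
theorem boxDiscrepancy_le_osc (hy1 : ∀ n, y n < 1)
    {L U : ℝ} (hL : ∀ t ∈ Icc (0 : ℝ) 1, L ≤ delta y t) (hU : ∀ t ∈ Icc (0 : ℝ) 1, delta y t ≤ U) :
    boxDiscrepancy y ≤ U - L := by
  unfold boxDiscrepancy
  refine csSup_le ?_ ?_
  · exact ⟨_, ⟨(0, 0), ⟨le_rfl, le_rfl, zero_le_one⟩, rfl⟩⟩
  · rintro _ ⟨⟨a, b⟩, ⟨ha, hab, hb⟩, rfl⟩
    simp only
    unfold localDisc
    have hbI : b ∈ Icc (0 : ℝ) 1 := ⟨ha.trans hab, hb⟩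
    have haI : a ∈ Icc (0 : ℝ) 1 := ⟨ha, hab.trans hb⟩
    obtain ⟨h1, h2⟩ := deltaPlus_mem hy1 hbI hL hU
    have h3 := hL a haI
    have h4 := hU a haI
    rw [card_Icc_eq y hab, sub_div]
    have e : b - a - ((countLE y b : ℝ) / N - (countLT y a : ℝ) / N) =
        delta y a - ((countLE y b : ℝ) / N - b) := by unfold delta; ring
    rw [e, abs_le]
    constructor <;> linarith

/-! ### The envelope lower bound `∫ (Δ − m)² ≥ (u³ + v³)/3` -/

/-- `∫₀¹ ((c − s)⁺)² ds ≥ c³/3` for `c ≤ 1`. [folklore] -/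
theorem integral_posPart_sq_ge {c : ℝ} (hc : c ≤ 1) :
    c ^ 3 / 3 ≤ ∫ s in (0 : ℝ)..1, (max (c - s) 0) ^ 2 := by
  rcases le_or_gt c 0 with hc0 | hc0
  · have h1 : c ^ 3 / 3 ≤ 0 := by
      have : c ^ 3 ≤ 0 := by nlinarith [sq_nonneg c]
      linarith
    refine h1.trans (intervalIntegral.integral_nonneg zero_le_one fun s _ => sq_nonneg _)
  · have hcont : Continuous fun s : ℝ => (max (c - s) 0) ^ 2 := by fun_prop
    rw [← integral_add_adjacent_intervals (b := c) (hcont.intervalIntegrable _ _)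
      (hcont.intervalIntegrable _ _)]
    have h1 : ∫ s in (0 : ℝ)..c, (max (c - s) 0) ^ 2 = c ^ 3 / 3 := by
      rw [integral_congr (g := fun s => (s - c) ^ 2) (fun s hs => by
        rw [uIcc_of_le hc0.le] at hs
        simp only [max_eq_left (sub_nonneg.mpr hs.2)]; ring)]
      have := integral_comp_sub_right (fun s : ℝ => s ^ 2) c (a := 0) (b := c)
      rw [this, integral_pow]
      norm_num
      ring
    have h2 : 0 ≤ ∫ s in c..(1 : ℝ), (max (c - s) 0) ^ 2 :=
      intervalIntegral.integral_nonneg hc (fun s _ => sq_nonneg _)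
    linarith

/-- The arc-length function from `x₀` to `x` (positive direction) on the circle `[0,1)`. [folklore] -/
def arcLen (x₀ x : ℝ) : ℝ := if x₀ ≤ x then x - x₀ else 1 - x₀ + x

/-- `∫₀¹ ((c − arcLen x₀ x)⁺)² dx ≥ c³/3` for `c ≤ 1`, `x₀ ∈ [0,1]` (the integrand is a rotate of
`((c − s)⁺)²`), together with the integrability of the integrand. [folklore] -/
theorem envelope_integral_ge {c x₀ : ℝ} (hc : c ≤ 1) (hx₀ : x₀ ∈ Icc (0 : ℝ) 1) :
    IntervalIntegrable (fun x => (max (c - arcLen x₀ x) 0) ^ 2) volume 0 1 ∧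
      c ^ 3 / 3 ≤ ∫ x in (0 : ℝ)..1, (max (c - arcLen x₀ x) 0) ^ 2 := by
  have hcont1 : Continuous fun x : ℝ => (max (c - (x - x₀)) 0) ^ 2 := by fun_prop
  have hcont2 : Continuous fun x : ℝ => (max (c - (1 - x₀ + x)) 0) ^ 2 := by fun_prop
  -- split at `x₀`
  have hpiece1 : IntervalIntegrable (fun x => (max (c - arcLen x₀ x) 0) ^ 2) volume 0 x₀ ∧
      ∫ x in (0 : ℝ)..x₀, (max (c - arcLen x₀ x) 0) ^ 2 =
        ∫ x in (0 : ℝ)..x₀, (max (c - (1 - x₀ + x)) 0) ^ 2 := by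
    have h : EqOn (fun x => (max (c - arcLen x₀ x) 0) ^ 2)
        (fun x => (max (c - (1 - x₀ + x)) 0) ^ 2) (Ioo 0 x₀) := fun x hx => by
      simp only [arcLen, if_neg (not_le.mpr hx.2)]
    exact ⟨(hcont2.intervalIntegrable _ _).congr_uIoo (by rw [uIoo_of_le hx₀.1]; exact h.symm),
      integral_congr_Ioo_of_le hx₀.1 h⟩
  have hpiece2 : IntervalIntegrable (fun x => (max (c - arcLen x₀ x) 0) ^ 2) volume x₀ 1 ∧
      ∫ x in x₀..(1 : ℝ), (max (c - arcLen x₀ x) 0) ^ 2 =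
        ∫ x in x₀..(1 : ℝ), (max (c - (x - x₀)) 0) ^ 2 := by
    have h : EqOn (fun x => (max (c - arcLen x₀ x) 0) ^ 2)
        (fun x => (max (c - (x - x₀)) 0) ^ 2) (Ioo x₀ 1) := fun x hx => by
      simp only [arcLen, if_pos hx.1.le]
    exact ⟨(hcont1.intervalIntegrable _ _).congr_uIoo (by rw [uIoo_of_le hx₀.2]; exact h.symm),
      integral_congr_Ioo_of_le hx₀.2 h⟩
  refine ⟨hpiece1.1.trans hpiece2.1, ?_⟩
  rw [← integral_add_adjacent_intervals hpiece1.1 hpiece2.1, hpiece1.2, hpiece2.2]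
  -- substitute
  have e1 : ∫ x in (0 : ℝ)..x₀, (max (c - (1 - x₀ + x)) 0) ^ 2 =
      ∫ s in (1 - x₀)..(1 : ℝ), (max (c - s) 0) ^ 2 := by
    have := integral_comp_add_left (fun s : ℝ => (max (c - s) 0) ^ 2) (1 - x₀) (a := 0) (b := x₀)
    rw [this]
    congr 1 <;> ring
  have e2 : ∫ x in x₀..(1 : ℝ), (max (c - (x - x₀)) 0) ^ 2 =
      ∫ s in (0 : ℝ)..(1 - x₀), (max (c - s) 0) ^ 2 := by
    have := integral_comp_sub_right (fun s : ℝ => (max (c - s) 0) ^ 2) x₀ (a := x₀) (b := 1)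
    rw [this]
    congr 1; ring
  rw [e1, e2, add_comm]
  have hcont : Continuous fun s : ℝ => (max (c - s) 0) ^ 2 := by fun_prop
  rw [integral_add_adjacent_intervals (hcont.intervalIntegrable _ _) (hcont.intervalIntegrable _ _)]
  exact integral_posPart_sq_ge hc

/-- `arcLen t x₁ = arcLen (1 − x₁) (1 − t)` (reflection). [folklore] -/
theorem arcLen_reflect (t x₁ : ℝ) : arcLen t x₁ = arcLen (1 - x₁) (1 - t) := by
  unfold arcLen
  by_cases h : t ≤ x₁
  · rw [if_pos h, if_pos (by linarith)]; ring
  · rw [if_neg h, if_neg (by push Not at h ⊢; linarith)]; ring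

/-- The reflected envelope: `∫₀¹ ((c − arcLen t x₁)⁺)² dt ≥ c³/3`. [folklore] -/
theorem envelope'_integral_ge {c x₁ : ℝ} (hc : c ≤ 1) (hx₁ : x₁ ∈ Icc (0 : ℝ) 1) :
    IntervalIntegrable (fun t => (max (c - arcLen t x₁) 0) ^ 2) volume 0 1 ∧
      c ^ 3 / 3 ≤ ∫ t in (0 : ℝ)..1, (max (c - arcLen t x₁) 0) ^ 2 := by
  have hx₁' : 1 - x₁ ∈ Icc (0 : ℝ) 1 := ⟨by linarith [hx₁.2], by linarith [hx₁.1]⟩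
  obtain ⟨hint, hge⟩ := envelope_integral_ge hc hx₁'
  have hfun : (fun t => (max (c - arcLen t x₁) 0) ^ 2) =
      fun t => (fun s => (max (c - arcLen (1 - x₁) s) 0) ^ 2) (1 - t) := by
    funext t; simp only [arcLen_reflect t x₁]
  rw [hfun]
  constructor
  · have := (hint.comp_sub_left 1).symm
    simpa using this
  · rw [intervalIntegral.integral_comp_sub_left (fun s => (max (c - arcLen (1 - x₁) s) 0) ^ 2) 1]
    simpa using hge

/-- Pointwise: if `G ≥ e⁺` and `G ≤ −e⁻` then `G² ≥ ((e⁺)⁺)² + ((e⁻)⁺)²`. [folklore] -/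
theorem sq_ge_posPart_sq_add {G e₁ e₂ : ℝ} (h1 : e₁ ≤ G) (h2 : G ≤ -e₂) :
    (max e₁ 0) ^ 2 + (max e₂ 0) ^ 2 ≤ G ^ 2 := by
  rcases le_or_gt e₁ 0 with he₁ | he₁
  · rw [max_eq_right he₁]
    rcases le_or_gt e₂ 0 with he₂ | he₂
    · rw [max_eq_right he₂]; nlinarith [sq_nonneg G]
    · rw [max_eq_left he₂.le]; nlinarith
  · rw [max_eq_left he₁.le]
    have he₂ : e₂ < 0 := by linarith
    rw [max_eq_right he₂.le]; nlinarith

/-- **The envelope lower bound.** For any `m`, near-extremal points `x₀` (where `Δ − m ≥ u − η`)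
and `x₁` (where `Δ − m ≤ −(v − η)`) with `u − η, v − η ≤ 1` give
`∫₀¹ (Δ − m)² ≥ ((u−η)³ + (v−η)³)/3`. [folklore] -/
theorem integral_sq_ge_of_near_extremal (hN : 0 < N) (hy0 : ∀ n, 0 ≤ y n) (hy1 : ∀ n, y n < 1)
    (m : ℝ) {u v η : ℝ} (hu : u - η ≤ 1) (hv : v - η ≤ 1)
    {x₀ x₁ : ℝ} (hx₀ : x₀ ∈ Icc (0 : ℝ) 1) (hx₁ : x₁ ∈ Icc (0 : ℝ) 1)
    (h₀ : u - η ≤ delta y x₀ - m) (h₁ : delta y x₁ - m ≤ -(v - η))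
    (hint : IntervalIntegrable (fun t => (delta y t - m) ^ 2) volume 0 1) :
    ((u - η) ^ 3 + (v - η) ^ 3) / 3 ≤ ∫ t in (0 : ℝ)..1, (delta y t - m) ^ 2 := by
  obtain ⟨hi₀, hge₀⟩ := envelope_integral_ge hu hx₀
  obtain ⟨hi₁, hge₁⟩ := envelope'_integral_ge hv hx₁
  have hpt : ∀ t ∈ Icc (0 : ℝ) 1,
      (max (u - η - arcLen x₀ t) 0) ^ 2 + (max (v - η - arcLen t x₁) 0) ^ 2 ≤
        (delta y t - m) ^ 2 := by
    intro t ht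
    refine sq_ge_posPart_sq_add ?_ ?_
    · have := delta_ge_of_arc hN hy0 hy1 hx₀ ht
      unfold arcLen; linarith
    · have := delta_le_of_arc hN hy0 hy1 hx₁ ht
      unfold arcLen; linarith
  have hmono := intervalIntegral.integral_mono_on zero_le_one (hi₀.add hi₁) hint hpt
  rw [intervalIntegral.integral_add hi₀ hi₁] at hmono
  linarith

/-! ### Measurability and the mean of `Δ` -/

/-- `#{y_n < t}` as a sum of indicators. [folklore] -/
theorem countLT_eq_sum (y : Fin N → ℝ) (t : ℝ) :
    (countLT y t : ℝ) = ∑ n, if y n < t then (1 : ℝ) else 0 := by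
  unfold countLT
  rw [Finset.card_filter]
  push_cast
  rfl

/-- `#{y_n < t}` as a sum of indicators, complex form. [folklore] -/
theorem countLT_eq_sum_complex (y : Fin N → ℝ) (t : ℝ) :
    ((countLT y t : ℕ) : ℂ) = ∑ n, if y n < t then (1 : ℂ) else 0 := by
  unfold countLT
  rw [Finset.card_filter]
  push_cast
  rfl

/-- `Δ` is measurable. [folklore] -/
theorem measurable_delta (y : Fin N → ℝ) : Measurable (delta y) := by
  have h : delta y = fun t => (∑ n, if y n < t then (1 : ℝ) else 0) / N - t := by
    funext t; rw [delta, countLT_eq_sum]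
  rw [h]
  refine Measurable.sub (Measurable.div_const (Finset.measurable_sum _ fun n _ => ?_) _)
    measurable_id
  exact Measurable.ite measurableSet_Ioi measurable_const measurable_const

/-- `Δ t − Δ s ≤ 1` (the count is at most `N`) for `s ≤ t` in `[0,1]`... in fact for all `s,t`
with `t − s ≥ 0`; we only need: `Δ t − Δ s ≤ 1 − (t − s) ≤ 1`. [folklore] -/
theorem delta_sub_delta_le (hN : 0 < N) (s t : ℝ) : delta y t - delta y s ≤ 1 - (t - s) := by
  unfold delta
  have h1 : (countLT y t : ℝ) ≤ N := by exact_mod_cast countLT_le y t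
  have h2 : (0 : ℝ) ≤ countLT y s := Nat.cast_nonneg _
  have hN' : (0 : ℝ) < N := by exact_mod_cast hN
  have e1 : (countLT y t : ℝ) / N ≤ 1 := (div_le_one hN').mpr h1
  have e2 : (0 : ℝ) ≤ (countLT y s : ℝ) / N := div_nonneg h2 hN'.le
  linarith

/-- The oscillation of `Δ` on `[0,1]` is at most `1`. [folklore] -/
theorem delta_sub_delta_le_one (hN : 0 < N) {s t : ℝ}
    (hs : s ∈ Icc (0 : ℝ) 1) (ht : t ∈ Icc (0 : ℝ) 1) : delta y t - delta y s ≤ 1 := by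
  rcases le_or_gt s t with h | h
  · have := delta_sub_delta_le (y := y) hN s t; linarith [sub_nonneg.mpr h]
  · have := delta_sub_delta_ge y h.le; linarith [hs.2, ht.1]

/-! ### Weyl sums and the Fourier coefficients of `Δ − m` -/

/-- The Weyl (exponential) sums `S_h = Σ_n e(h y_n)`, `e(t) = exp(2πit)`. [folklore] -/
def weylSum (y : Fin N → ℝ) (h : ℤ) : ℂ := ∑ n, Complex.exp (2 * Real.pi * Complex.I * h * y n)

/-- `‖S_h‖ ≤ N`. [folklore] -/
theorem norm_weylSum_le (y : Fin N → ℝ) (h : ℤ) : ‖weylSum y h‖ ≤ N := by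
  unfold weylSum
  calc ‖∑ n, Complex.exp (2 * Real.pi * Complex.I * h * y n)‖
      ≤ ∑ n : Fin N, ‖Complex.exp (2 * Real.pi * Complex.I * h * y n)‖ := norm_sum_le _ _
    _ = ∑ _n : Fin N, (1 : ℝ) := Finset.sum_congr rfl fun n _ => by
        rw [Complex.norm_exp]
        simp
    _ = N := by simp

/-- `S_{−h} = conj S_h`, so `‖S_{−h}‖ = ‖S_h‖`. [folklore] -/
theorem norm_weylSum_neg (y : Fin N → ℝ) (h : ℤ) : ‖weylSum y (-h)‖ = ‖weylSum y h‖ := by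
  have : weylSum y (-h) = (starRingEnd ℂ) (weylSum y h) := by
    unfold weylSum
    rw [map_sum]
    refine Finset.sum_congr rfl fun n _ => ?_
    rw [← Complex.exp_conj]
    congr 1
    simp only [map_mul, Complex.conj_ofReal, Complex.conj_I, map_intCast, Int.cast_neg,
      map_ofNat]
    ring
  rw [this, Complex.norm_conj]

/-- The mean `m = ∫₀¹ Δ`. [folklore] -/
def meanDelta (y : Fin N → ℝ) : ℝ := ∫ t in (0 : ℝ)..1, delta y t

/-- The centred discrepancy function as a complex-valued function, `f = Δ − m`. [folklore] -/
def centred (y : Fin N → ℝ) (t : ℝ) : ℂ := ((delta y t - meanDelta y : ℝ) : ℂ)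

/-- Transfer of the integral along an equality on the open interval (complex-valued). [folklore] -/
theorem integral_eq_of_eqOn_Ioo' {f g : ℝ → ℂ} {a b : ℝ} (hab : a ≤ b)
    (hg : IntervalIntegrable g volume a b) (h : EqOn f g (Ioo a b)) :
    IntervalIntegrable f volume a b ∧ ∫ t in a..b, f t = ∫ t in a..b, g t :=
  ⟨hg.congr_uIoo (by rw [uIoo_of_le hab]; exact h.symm), integral_congr_Ioo_of_le hab h⟩

/-- `∫₀¹ e^{cx} 1_{y_n < x} dx = (e^{c} − e^{c y_n})/c` for `y_n ∈ [0,1]`, `c ≠ 0`. [folklore] -/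
theorem integral_exp_mul_indicator {c : ℂ} (hc : c ≠ 0) {a : ℝ} (ha : a ∈ Icc (0 : ℝ) 1) :
    IntervalIntegrable (fun x : ℝ => Complex.exp (c * x) * (if a < x then (1 : ℂ) else 0)) volume 0 1 ∧
    ∫ x in (0 : ℝ)..1, Complex.exp (c * x) * (if a < x then (1 : ℂ) else 0) =
      (Complex.exp (c * 1) - Complex.exp (c * a)) / c := by
  have hcont : Continuous fun x : ℝ => Complex.exp (c * x) := by fun_prop
  have p1 := integral_eq_of_eqOn_Ioo' ha.1 (g := fun _ => (0 : ℂ)) intervalIntegrable_const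
    (f := fun x : ℝ => Complex.exp (c * x) * (if a < x then (1 : ℂ) else 0))
    (fun x hx => by simp only [if_neg (not_lt.mpr hx.2.le), mul_zero])
  have p2 := integral_eq_of_eqOn_Ioo' ha.2 (hcont.intervalIntegrable _ _)
    (f := fun x : ℝ => Complex.exp (c * x) * (if a < x then (1 : ℂ) else 0))
    (fun x hx => by simp only [if_pos hx.1, mul_one])
  refine ⟨p1.1.trans p2.1, ?_⟩
  rw [← integral_add_adjacent_intervals p1.1 p2.1, p1.2, p2.2, intervalIntegral.integral_const,
    smul_zero, zero_add, integral_exp_mul_complex hc]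
  simp

/-- `∫₀¹ x e^{cx} dx = ((c − 1) e^{c} + 1)/c²` (`c ≠ 0`). [folklore] -/
theorem integral_mul_exp {c : ℂ} (hc : c ≠ 0) :
    ∫ x in (0 : ℝ)..1, Complex.exp (c * x) * (x : ℂ) =
      ((c - 1) * Complex.exp c + 1) / c ^ 2 := by
  have hderiv : ∀ x ∈ uIcc (0 : ℝ) 1,
      HasDerivAt (fun x : ℝ => (c * (x : ℂ) - 1) * Complex.exp (c * x) / c ^ 2)
        (Complex.exp (c * x) * (x : ℂ)) x := by
    intro x _
    have h1 : HasDerivAt (fun x : ℝ => (c * (x : ℂ) - 1)) c x := by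
      have : HasDerivAt (fun z : ℂ => c * z - 1) (c * 1) (x : ℂ) :=
        ((hasDerivAt_id (x : ℂ)).const_mul c).sub_const 1
      rw [mul_one] at this
      exact this.comp_ofReal
    have h2 : HasDerivAt (fun x : ℝ => Complex.exp (c * x)) (Complex.exp (c * x) * c) x := by
      have : HasDerivAt (fun z : ℂ => Complex.exp (c * z)) (Complex.exp (c * x) * (c * 1)) (x : ℂ) :=
        ((hasDerivAt_id (x : ℂ)).const_mul c).cexp
      rw [mul_one] at this
      exact this.comp_ofReal
    have h := (h1.mul h2).div_const (c ^ 2)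
    have h' : (c * Complex.exp (c * x) + (c * x - 1) * (Complex.exp (c * x) * c)) / c ^ 2 =
        Complex.exp (c * x) * x := by
      rw [div_eq_iff (pow_ne_zero 2 hc)]; ring
    rw [h'] at h
    exact h
  have hcont : Continuous fun x : ℝ => Complex.exp (c * x) * (x : ℂ) := by fun_prop
  rw [integral_eq_sub_of_hasDerivAt hderiv (hcont.intervalIntegrable _ _)]
  simp only [Complex.ofReal_one, mul_one, Complex.ofReal_zero, mul_zero, zero_sub,
    Complex.exp_zero]
  field_simp
  ring

/-- **The Fourier coefficients of `Δ − m`**: for `h ≠ 0`,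
`ĉ(h) = ∫₀¹ e(−hx)(Δ(x) − m) dx = S_{−h} / (2πi h N)`. [folklore] -/
theorem fourierCoeffOn_centred (hN : 0 < N) (hy0 : ∀ n, 0 ≤ y n) (hy1 : ∀ n, y n < 1) {h : ℤ}
    (hh : h ≠ 0) :
    fourierCoeffOn zero_lt_one (centred y) h =
      weylSum y (-h) / (2 * Real.pi * Complex.I * h * N) := by
  set c : ℂ := -(2 * Real.pi * Complex.I * h) with hc
  have hc0 : c ≠ 0 := by
    rw [hc, neg_ne_zero]
    have : (h : ℂ) ≠ 0 := by exact_mod_cast hh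
    have hpi : (Real.pi : ℂ) ≠ 0 := by exact_mod_cast Real.pi_ne_zero
    exact mul_ne_zero (mul_ne_zero (mul_ne_zero two_ne_zero hpi) Complex.I_ne_zero) this
  have hexp1 : Complex.exp c = 1 := by
    have := Complex.exp_int_mul_two_pi_mul_I (-h)
    rw [← this, hc]; congr 1; push_cast; ring
  have hNc : (N : ℂ) ≠ 0 := by exact_mod_cast hN.ne'
  -- the integrand
  have hker : ∀ x : ℝ, fourier (-h) (x : AddCircle ((1 : ℝ) - 0)) • centred y x =
      Complex.exp (c * x) * ((∑ n, if y n < x then (1 : ℂ) else 0) / N) -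
        Complex.exp (c * x) * (x : ℂ) - Complex.exp (c * x) * (meanDelta y : ℂ) := by
    intro x
    rw [fourier_coe_apply, smul_eq_mul, centred, delta]
    have e : (2 * Real.pi * Complex.I * ((-h : ℤ) : ℂ) * x / ((1 : ℝ) - 0 : ℝ) : ℂ) = c * x := by
      push_cast; rw [hc]; ring
    rw [e]
    push_cast
    rw [countLT_eq_sum_complex]
    ring
  rw [fourierCoeffOn_eq_integral, intervalIntegral.integral_congr (fun x _ => hker x), sub_zero,
    div_one, one_smul]
  -- integrate term by term
  have hE : Continuous fun x : ℝ => Complex.exp (c * x) := by fun_prop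
  have hi1 : ∀ n, IntervalIntegrable (fun x : ℝ => Complex.exp (c * x) *
      (if y n < x then (1 : ℂ) else 0)) volume 0 1 :=
    fun n => (integral_exp_mul_indicator hc0 ⟨hy0 n, (hy1 n).le⟩).1
  have hiS : IntervalIntegrable (fun x : ℝ => Complex.exp (c * x) *
      ((∑ n, if y n < x then (1 : ℂ) else 0) / N)) volume 0 1 := by
    have hiS' : IntervalIntegrable
        (∑ n, fun x : ℝ => Complex.exp (c * x) * (if y n < x then (1 : ℂ) else 0)) volume 0 1 :=
      IntervalIntegrable.sum _ fun n _ => hi1 n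
    have : (fun x : ℝ => Complex.exp (c * x) * ((∑ n, if y n < x then (1 : ℂ) else 0) / N)) =
        fun x : ℝ => (∑ n, fun x : ℝ => Complex.exp (c * x) * (if y n < x then (1 : ℂ) else 0)) x
          / N := by
      funext x; rw [Finset.sum_apply, mul_div_assoc', Finset.mul_sum]
    rw [this]
    exact hiS'.div_const _
  have hi2 : IntervalIntegrable (fun x : ℝ => Complex.exp (c * x) * (x : ℂ)) volume 0 1 :=
    (Continuous.mul hE Complex.continuous_ofReal).intervalIntegrable _ _
  have hi3 : IntervalIntegrable (fun x : ℝ => Complex.exp (c * x) * (meanDelta y : ℂ)) volume 0 1 :=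
    (hE.mul continuous_const).intervalIntegrable _ _
  rw [intervalIntegral.integral_sub (hiS.sub hi2) hi3, intervalIntegral.integral_sub hiS hi2]
  -- the three integrals
  have I1 : ∫ x in (0 : ℝ)..1, Complex.exp (c * x) * ((∑ n, if y n < x then (1 : ℂ) else 0) / N) =
      ((N : ℂ) - weylSum y (-h)) / (c * N) := by
    have : (fun x : ℝ => Complex.exp (c * x) * ((∑ n, if y n < x then (1 : ℂ) else 0) / N)) =
        fun x : ℝ => (∑ n, Complex.exp (c * x) * (if y n < x then (1 : ℂ) else 0)) / N := by
      funext x; rw [mul_div_assoc', Finset.mul_sum]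
    rw [this, intervalIntegral.integral_div, intervalIntegral.integral_finsetSum (fun n _ => hi1 n)]
    rw [Finset.sum_congr rfl fun n _ => (integral_exp_mul_indicator hc0 ⟨hy0 n, (hy1 n).le⟩).2]
    simp only [mul_one, hexp1]
    rw [weylSum, ← Finset.sum_div, Finset.sum_sub_distrib, Finset.sum_const, Finset.card_univ,
      Fintype.card_fin, nsmul_eq_mul, mul_one]
    have e2 : ∀ n, Complex.exp (c * (y n : ℂ)) =
        Complex.exp (2 * Real.pi * Complex.I * ((-h : ℤ) : ℂ) * (y n : ℂ)) := by
      intro n; congr 1; push_cast; rw [hc]; ring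
    simp_rw [e2]
    field_simp
  have I2 : ∫ x in (0 : ℝ)..1, Complex.exp (c * x) * (x : ℂ) = 1 / c := by
    rw [integral_mul_exp hc0, hexp1]
    field_simp
    ring
  have I3 : ∫ x in (0 : ℝ)..1, Complex.exp (c * x) * (meanDelta y : ℂ) = 0 := by
    rw [intervalIntegral.integral_mul_const, integral_exp_mul_complex hc0]
    simp [hexp1]
  rw [I1, I2, I3]
  simp only [sub_zero, one_div]
  rw [hc]
  field_simp
  ring

/-! ### Integrability, the zeroth coefficient, Parseval -/

/-- `Δ` is integrable on `[0,1]`. [folklore] -/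
theorem intervalIntegrable_delta (hN : 0 < N) (hy0 : ∀ n, 0 ≤ y n) (hy1 : ∀ n, y n < 1) :
    IntervalIntegrable (delta y) volume 0 1 := by
  rw [intervalIntegrable_iff, uIoc_of_le zero_le_one]
  refine Measure.integrableOn_of_bounded (M := 1) measure_Ioc_lt_top.ne
    (measurable_delta y).aestronglyMeasurable ?_
  refine (ae_restrict_iff' measurableSet_Ioc).mpr (ae_of_all _ fun t ht => ?_)
  rw [Real.norm_eq_abs]
  exact abs_delta_le hN hy0 hy1 ⟨ht.1.le, ht.2⟩

/-- `|m| ≤ 1`. [folklore] -/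
theorem abs_meanDelta_le (hN : 0 < N) (hy0 : ∀ n, 0 ≤ y n) (hy1 : ∀ n, y n < 1) :
    |meanDelta y| ≤ 1 := by
  unfold meanDelta
  have h := intervalIntegral.norm_integral_le_of_norm_le_const (a := (0 : ℝ)) (b := 1) (C := 1)
    (f := delta y) (fun t ht => by
      rw [uIoc_of_le zero_le_one] at ht
      rw [Real.norm_eq_abs]; exact abs_delta_le hN hy0 hy1 ⟨ht.1.le, ht.2⟩)
  rw [Real.norm_eq_abs] at h
  simpa using h

/-- `|Δ − m| ≤ 2` on `[0,1]`. [folklore] -/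
theorem norm_centred_le (hN : 0 < N) (hy0 : ∀ n, 0 ≤ y n) (hy1 : ∀ n, y n < 1) {t : ℝ}
    (ht : t ∈ Icc (0 : ℝ) 1) : ‖centred y t‖ ≤ 2 := by
  unfold centred
  rw [Complex.norm_real, Real.norm_eq_abs]
  have h1 := abs_delta_le hN hy0 hy1 ht
  have h2 := abs_meanDelta_le hN hy0 hy1
  calc |delta y t - meanDelta y| ≤ |delta y t| + |meanDelta y| := abs_sub _ _
    _ ≤ 2 := by linarith

/-- `Δ − m ∈ L²(0,1)`. [folklore] -/
theorem memLp_centred (hN : 0 < N) (hy0 : ∀ n, 0 ≤ y n) (hy1 : ∀ n, y n < 1) :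
    MemLp (centred y) 2 (volume.restrict (Ioc (0 : ℝ) 1)) := by
  haveI : IsFiniteMeasure (volume.restrict (Ioc (0 : ℝ) 1)) :=
    ⟨by rw [Measure.restrict_apply_univ]; exact measure_Ioc_lt_top⟩
  refine MemLp.of_bound ?_ 2 ?_
  · exact (Complex.measurable_ofReal.comp ((measurable_delta y).sub_const _)).aestronglyMeasurable
  · refine (ae_restrict_iff' measurableSet_Ioc).mpr (ae_of_all _ fun t ht => ?_)
    exact norm_centred_le hN hy0 hy1 ⟨ht.1.le, ht.2⟩

/-- The zeroth Fourier coefficient of `Δ − m` vanishes (`m` is the mean). [folklore] -/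
theorem fourierCoeffOn_centred_zero (hN : 0 < N) (hy0 : ∀ n, 0 ≤ y n) (hy1 : ∀ n, y n < 1) :
    fourierCoeffOn zero_lt_one (centred y) 0 = 0 := by
  rw [fourierCoeffOn_eq_integral]
  have hker : ∀ x : ℝ, fourier (-0) (x : AddCircle ((1 : ℝ) - 0)) • centred y x = centred y x := by
    intro x
    rw [fourier_coe_apply, smul_eq_mul]
    simp
  rw [intervalIntegral.integral_congr (fun x _ => hker x), sub_zero, div_one, one_smul]
  unfold centred
  rw [intervalIntegral.integral_ofReal, intervalIntegral.integral_sub (intervalIntegrable_delta hN hy0 hy1)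
    intervalIntegrable_const, intervalIntegral.integral_const]
  simp [meanDelta]

/-- **Parseval for `Δ − m`**: `Σ_{n≥1} ‖S_n‖²/(2π² n² N²) = ∫₀¹ (Δ − m)²`. [folklore] -/
theorem hasSum_weylSum_sq (hN : 0 < N) (hy0 : ∀ n, 0 ≤ y n) (hy1 : ∀ n, y n < 1) :
    HasSum (fun n : ℕ => ‖weylSum y (n + 1)‖ ^ 2 / (2 * Real.pi ^ 2 * ((n : ℝ) + 1) ^ 2 * N ^ 2))
      (∫ t in (0 : ℝ)..1, (delta y t - meanDelta y) ^ 2) := by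
  have hP := hasSum_sq_fourierCoeffOn zero_lt_one (memLp_centred hN hy0 hy1)
  -- the right-hand side
  have hrhs : ((1 : ℝ) - 0)⁻¹ • ∫ x in (0 : ℝ)..1, ‖centred y x‖ ^ 2 =
      ∫ t in (0 : ℝ)..1, (delta y t - meanDelta y) ^ 2 := by
    rw [sub_zero, inv_one, one_smul]
    refine intervalIntegral.integral_congr fun t _ => ?_
    simp only [centred, Complex.norm_real, Real.norm_eq_abs, sq_abs]
  rw [hrhs] at hP
  set I := ∫ t in (0 : ℝ)..1, (delta y t - meanDelta y) ^ 2 with hI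
  -- the coefficients
  set T : ℕ → ℝ := fun k => ‖weylSum y k‖ ^ 2 / (4 * Real.pi ^ 2 * (k : ℝ) ^ 2 * N ^ 2) with hT
  have hcoef : ∀ i : ℤ, i ≠ 0 →
      ‖fourierCoeffOn zero_lt_one (centred y) i‖ ^ 2 =
        ‖weylSum y i‖ ^ 2 / (4 * Real.pi ^ 2 * (i : ℝ) ^ 2 * N ^ 2) := by
    intro i hi
    rw [fourierCoeffOn_centred hN hy0 hy1 hi, norm_div, norm_weylSum_neg, div_pow]
    congr 1
    simp only [norm_mul, Complex.norm_real, Real.norm_eq_abs, Complex.norm_I, Complex.norm_intCast,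
      Complex.norm_natCast, Complex.norm_ofNat, abs_of_pos Real.pi_pos, mul_pow, sq_abs]
    ring
  -- pass from `ℤ` to `ℕ`
  have hg := hP.nat_add_neg_add_one
  set b : ℕ → ℝ := fun n => T (n + 1) with hb
  have hb0 : ∀ n, 0 ≤ b n := fun n => by simp only [hb, hT]; positivity
  have hgeq : ∀ n : ℕ, ‖fourierCoeffOn zero_lt_one (centred y) n‖ ^ 2 +
      ‖fourierCoeffOn zero_lt_one (centred y) (-(n + 1))‖ ^ 2 =
        (if n = 0 then 0 else b (n - 1)) + b n := by
    intro n
    congr 1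
    · rcases Nat.eq_zero_or_pos n with rfl | hn
      · simp [fourierCoeffOn_centred_zero hN hy0 hy1]
      · rw [if_neg hn.ne', hcoef n (by exact_mod_cast hn.ne'), hb, hT]
        simp only
        obtain ⟨k, rfl⟩ : ∃ k, n = k + 1 := ⟨n - 1, by omega⟩
        simp
    · rw [hcoef (-(n + 1)) (by omega), hb, hT]
      simp only
      rw [show ((-((n : ℤ) + 1) : ℤ)) = -(((n + 1 : ℕ)) : ℤ) by push_cast; ring,
        norm_weylSum_neg]
      push_cast
      ring
  simp_rw [hgeq] at hg
  -- `b` is summable (bounded by the terms of `hg`)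
  have hd : ∀ n : ℕ, (0 : ℝ) ≤ (if n = 0 then 0 else b (n - 1)) := fun n => by
    split_ifs <;> [exact le_rfl; exact hb0 _]
  have hbsum : Summable b :=
    Summable.of_nonneg_of_le hb0 (fun n => le_add_of_nonneg_left (hd n)) hg.summable
  obtain ⟨B, hB⟩ := hbsum
  have hB' : HasSum (fun n : ℕ => (if n = 0 then 0 else b (n - 1))) B := by
    rw [← hasSum_nat_add_iff' 1]
    simpa using hB
  have h2 : I = B + B := hg.unique (hB'.add hB)
  have hfin : HasSum (fun n => 2 * b n) I := by rw [h2, ← two_mul]; exact hB.mul_left 2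
  convert hfin using 1
  funext n
  simp only [hb, hT]
  push_cast
  field_simp
  ring

/-! ### LeVeque's inequality -/

/-- The discrepancy is nonnegative. [folklore] -/
theorem boxDiscrepancy_nonneg (y : Fin N → ℝ) : 0 ≤ boxDiscrepancy y := by
  unfold boxDiscrepancy
  have hbdd : BddAbove ((fun ab : ℝ × ℝ => localDisc y ab.1 ab.2) ''
      {ab | 0 ≤ ab.1 ∧ ab.1 ≤ ab.2 ∧ ab.2 ≤ 1}) := by
    refine ⟨2, ?_⟩
    rintro _ ⟨⟨a, b⟩, ⟨ha, hab, hb⟩, rfl⟩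
    simp only
    unfold localDisc
    have h1 : |b - a| ≤ 1 := by rw [abs_le]; constructor <;> linarith
    have h2 : |((Finset.univ.filter fun n => a ≤ y n ∧ y n ≤ b).card : ℝ) / N| ≤ 1 := by
      rw [abs_of_nonneg (by positivity)]
      rcases Nat.eq_zero_or_pos N with hN | hN
      · subst hN; simp
      · rw [div_le_one (by exact_mod_cast hN)]
        exact_mod_cast (Finset.card_le_univ _).trans (by simp)
    calc _ ≤ |b - a| + |((Finset.univ.filter fun n => a ≤ y n ∧ y n ≤ b).card : ℝ) / N| :=
          abs_sub _ _
      _ ≤ 2 := by linarith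
  refine le_trans (abs_nonneg _) (le_csSup hbdd ⟨(0, 0), ⟨le_rfl, le_rfl, zero_le_one⟩, rfl⟩)

/-- **LeVeque's inequality** (W. J. LeVeque 1965; Kuipers–Niederreiter, *Uniform distribution of
sequences*, Ch. 2, Theorem 2.4): for `y₁, …, y_N ∈ [0,1)`,
`D_N³ ≤ (6/π²) Σ_{h ≥ 1} (1/h²) |S_h/N|²`, `S_h = Σ_n e^{2πi h y_n}`, where `D_N` is the box
discrepancy (here: supremum over closed subintervals, CDT Definition 44).
Proof: Parseval for `Δ − m` (`Δ(t) = #{y_n < t}/N − t`, `m` its mean), whose coefficients are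
`S_{−h}/(2πihN)`, and the envelope bound `∫(Δ − m)² ≥ (u³ + v³)/3 ≥ (u+v)³/12 ≥ D³/12`
(`u = sup`, `−v = inf` of `Δ − m`; along the circle `Δ` decreases with unit slope between its
upward jumps). [cite: KuipersNiederreiter1974, Ch. 2 Theorem 2.4 (LeVeque's inequality)] -/
theorem leVeque (hN : 0 < N) (hy0 : ∀ n, 0 ≤ y n) (hy1 : ∀ n, y n < 1) :
    boxDiscrepancy y ^ 3 ≤
      6 / Real.pi ^ 2 * ∑' n : ℕ, ‖weylSum y (n + 1)‖ ^ 2 / (((n : ℝ) + 1) ^ 2 * N ^ 2) := by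
  set m := meanDelta y with hm
  set G : ℝ → ℝ := fun t => delta y t - m with hG
  set I := ∫ t in (0 : ℝ)..1, (delta y t - meanDelta y) ^ 2 with hI
  -- the image of `[0,1]` under `G`
  set A := G '' Icc (0 : ℝ) 1 with hA
  have hAne : A.Nonempty := ⟨G 0, ⟨0, ⟨le_rfl, zero_le_one⟩, rfl⟩⟩
  have hGbd : ∀ t ∈ Icc (0 : ℝ) 1, |G t| ≤ 2 := fun t ht => by
    have h1 := abs_delta_le hN hy0 hy1 ht
    have h2 := abs_meanDelta_le hN hy0 hy1
    simp only [hG]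
    calc |delta y t - m| ≤ |delta y t| + |m| := abs_sub _ _
      _ ≤ 2 := by linarith
  have hAbdd : BddAbove A := ⟨2, by rintro _ ⟨t, ht, rfl⟩; exact (le_abs_self _).trans (hGbd t ht)⟩
  have hAbdd' : BddBelow A := ⟨-2, by rintro _ ⟨t, ht, rfl⟩; exact (neg_abs_le _).trans' (by
    linarith [hGbd t ht, neg_abs_le (G t)])⟩
  set u := sSup A with hu
  set v := -sInf A with hv
  have hGle : ∀ t ∈ Icc (0 : ℝ) 1, G t ≤ u := fun t ht => le_csSup hAbdd ⟨t, ht, rfl⟩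
  have hGge : ∀ t ∈ Icc (0 : ℝ) 1, -v ≤ G t := fun t ht => by
    rw [hv, neg_neg]; exact csInf_le hAbdd' ⟨t, ht, rfl⟩
  -- integrability
  have hiΔ := intervalIntegrable_delta hN hy0 hy1
  have hiG : IntervalIntegrable G volume 0 1 := hiΔ.sub intervalIntegrable_const
  have hiG2 : IntervalIntegrable (fun t => (delta y t - m) ^ 2) volume 0 1 := by
    rw [intervalIntegrable_iff, uIoc_of_le zero_le_one]
    refine Measure.integrableOn_of_bounded (M := 4) measure_Ioc_lt_top.ne
      (((measurable_delta y).sub_const _).pow_const 2).aestronglyMeasurable ?_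
    refine (ae_restrict_iff' measurableSet_Ioc).mpr (ae_of_all _ fun t ht => ?_)
    have h := hGbd t ⟨ht.1.le, ht.2⟩
    simp only [hG] at h
    rw [Real.norm_eq_abs, abs_pow, show (4 : ℝ) = 2 ^ 2 by norm_num]
    exact pow_le_pow_left₀ (abs_nonneg _) h 2
  -- `∫₀¹ G = 0`, hence `0 ≤ u`, `0 ≤ v`
  have hGint : ∫ t in (0 : ℝ)..1, G t = 0 := by
    simp only [hG]
    rw [intervalIntegral.integral_sub hiΔ intervalIntegrable_const, intervalIntegral.integral_const]
    simp [hm, meanDelta]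
  have hu0 : 0 ≤ u := by
    have h := intervalIntegral.integral_mono_on zero_le_one hiG intervalIntegrable_const
      (fun t ht => hGle t ht)
    rw [hGint, intervalIntegral.integral_const] at h
    simpa using h
  have hv0 : 0 ≤ v := by
    have h := intervalIntegral.integral_mono_on zero_le_one intervalIntegrable_const hiG
      (fun t ht => hGge t ht)
    rw [hGint, intervalIntegral.integral_const] at h
    simp at h
    linarith
  -- `u ≤ 1`, `v ≤ 1` (the oscillation of `Δ` is `≤ 1` and `m` is a mean)
  have hm_ge : ∀ t ∈ Icc (0 : ℝ) 1, delta y t - 1 ≤ m := by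
    intro t ht
    have h := intervalIntegral.integral_mono_on zero_le_one intervalIntegrable_const hiΔ
      (fun s hs => show delta y t - 1 ≤ delta y s by
        have := delta_sub_delta_le_one (y := y) hN hs ht; linarith)
    rw [intervalIntegral.integral_const] at h
    simpa [hm, meanDelta] using h
  have hm_le : ∀ t ∈ Icc (0 : ℝ) 1, m ≤ delta y t + 1 := by
    intro t ht
    have h := intervalIntegral.integral_mono_on zero_le_one hiΔ intervalIntegrable_const
      (fun s hs => show delta y s ≤ delta y t + 1 by
        have := delta_sub_delta_le_one (y := y) hN ht hs; linarith)
    rw [intervalIntegral.integral_const] at h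
    simpa [hm, meanDelta] using h
  have hu1 : u ≤ 1 := csSup_le hAne (by
    rintro _ ⟨t, ht, rfl⟩; simp only [hG]; linarith [hm_ge t ht])
  have hv1 : v ≤ 1 := by
    rw [hv, neg_le]
    refine le_csInf hAne ?_
    rintro _ ⟨t, ht, rfl⟩; simp only [hG]; linarith [hm_le t ht]
  -- the envelope bound for every `η ∈ (0, 1)`
  have henv : ∀ η : ℝ, 0 < η → ((u - η) ^ 3 + (v - η) ^ 3) / 3 ≤ I := by
    intro η hη
    obtain ⟨_, ⟨x₀, hx₀, rfl⟩, hx₀'⟩ := exists_lt_of_lt_csSup hAne (show u - η < u by linarith)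
    obtain ⟨_, ⟨x₁, hx₁, rfl⟩, hx₁'⟩ := exists_lt_of_csInf_lt hAne (show sInf A < -v + η by
      rw [hv, neg_neg]; linarith)
    exact integral_sq_ge_of_near_extremal hN hy0 hy1 m (by linarith) (by linarith) hx₀ hx₁
      (by simp only [hG] at hx₀'; linarith) (by simp only [hG] at hx₁'; linarith) hiG2
  -- let `η → 0`
  have hlim : (u ^ 3 + v ^ 3) / 3 ≤ I := by
    have hcont : Tendsto (fun η : ℝ => ((u - η) ^ 3 + (v - η) ^ 3) / 3) (𝓝[>] 0)
        (𝓝 (((u - 0) ^ 3 + (v - 0) ^ 3) / 3)) :=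
      ((by fun_prop : Continuous fun η : ℝ => ((u - η) ^ 3 + (v - η) ^ 3) / 3).tendsto 0).mono_left
        nhdsWithin_le_nhds
    simp only [sub_zero] at hcont
    exact le_of_tendsto hcont (eventually_nhdsWithin_of_forall fun η hη => henv η hη)
  -- `D ≤ u + v`
  have hD : boxDiscrepancy y ≤ u + v := by
    have h := boxDiscrepancy_le_osc hy1 (L := -v + m) (U := u + m)
      (fun t ht => by have := hGge t ht; simp only [hG] at this; linarith)
      (fun t ht => by have := hGle t ht; simp only [hG] at this; linarith)
    linarith
  have hD0 := boxDiscrepancy_nonneg y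
  -- Parseval
  have hsum := hasSum_weylSum_sq hN hy0 hy1
  rw [← hI] at hsum
  have hI_eq : I = ∑' n : ℕ, ‖weylSum y (n + 1)‖ ^ 2 / (2 * Real.pi ^ 2 * ((n : ℝ) + 1) ^ 2 * N ^ 2) :=
    hsum.tsum_eq.symm
  have htsum : ∑' n : ℕ, ‖weylSum y (n + 1)‖ ^ 2 / (((n : ℝ) + 1) ^ 2 * N ^ 2) =
      2 * Real.pi ^ 2 * I := by
    rw [hI_eq, ← tsum_mul_left]
    refine tsum_congr fun n => ?_
    field_simp
  -- conclude
  have hcube : (u + v) ^ 3 ≤ 4 * (u ^ 3 + v ^ 3) := by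
    nlinarith [sq_nonneg (u - v), mul_nonneg hu0 hv0, mul_nonneg (mul_nonneg hu0 hv0) (add_nonneg hu0 hv0)]
  calc boxDiscrepancy y ^ 3 ≤ (u + v) ^ 3 := pow_le_pow_left₀ hD0 hD 3
    _ ≤ 4 * (u ^ 3 + v ^ 3) := hcube
    _ ≤ 12 * I := by linarith
    _ = 6 / Real.pi ^ 2 * ∑' n : ℕ, ‖weylSum y (n + 1)‖ ^ 2 / (((n : ℝ) + 1) ^ 2 * N ^ 2) := by
        rw [htsum]; field_simp; ring

end Discrepancy

end Literature.NumberTheory.DiophantineApproximation
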